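import Mathlib
import Summits.QuantumFields.YangMills.Theses.IsotropyFromPowerCounting

/-!
# Crux-ideation sketch — `CurvatureSandwichBound` (stmt-QuantumFields-18372), ideator 1, round 1

First lemmas of the two idea cards (they must ELABORATE; proofs are not required):

* card `wedge-core-frame-transfer` (Σ_{e₀} ⟹ Σ_{45°} model-blindly):
  - `norm_le_of_denseCore_of_formalAdjoint` — an operator on a dense domain with a formal adjoint
    that is bounded on a dense sub-core is bounded on its whole domain (no closability axiom, no
    completeness needed);
  - `norm_le_of_chainGrowth` — the abstract multiple-reflection / iterated-Schwarz step: chain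
    growth `‖(X♯X)^(2^m) ψ‖ ≤ C_ψ Λ^(2·2^m)` with an ARBITRARY end constant `C_ψ` forces
    `‖Xψ‖ ≤ Λ‖ψ‖` (Glimm–Jaffe 1987 Thm 10.5.5 without `L∞` ends and without absolute values).
* card `pinned-cumulant-pressure` (Σ_{e₀} ⟸ factorial-free pinned cumulant sums on the lattice):
  - `sum_finpartition_prod_le_exp` — the positive-activity polymer bound
    `∑_π ∏_{B∈π} w B ≤ exp (∑_B w B)` that turns pinned cumulant sums into a growth rate
    after normalising by the pair scale.

The crux itself (by name): -/

namespace Summit.QuantumFields.YangMills.Cruxes.CurvatureSandwichBound.Ideation1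

open scoped InnerProductSpace BigOperators

/-- The target, by name (checks the import path). -/
abbrev Target : Prop :=
  Summit.QuantumFields.YangMills.Theses.IsotropyFromPowerCounting.CurvatureSandwichBound

section OperatorCore

variable {H : Type*} [NormedAddCommGroup H] [InnerProductSpace ℂ H]

/-- **(L-B1) Bounded on a dense core + formal adjoint ⇒ bounded on the whole domain.**
`D` = span of field vectors (dense), `X` = the diagonal-frame sandwich `Ψ_W ↦ Ψ_{f₁ ⊗ T W}`,
`Xs` = the reflected sandwich (formal adjoint on `D`), `E` = span of field vectors of ADMISSIBLE
(wedge-supported, doubly separated) ends. -/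
theorem norm_le_of_denseCore_of_formalAdjoint
    (D : Submodule ℂ H) (hD : Dense (D : Set H))
    (X Xs : D →ₗ[ℂ] H)
    (hadj : ∀ φ ψ : D, ⟪(φ : H), X ψ⟫_ℂ = ⟪Xs φ, (ψ : H)⟫_ℂ)
    (E : Submodule ℂ D) (hE : Dense ((fun ψ : D => (ψ : H)) '' (E : Set D)))
    (C : ℝ) (hC : 0 ≤ C) (hb : ∀ ψ ∈ E, ‖X ψ‖ ≤ C * ‖(ψ : H)‖) :
    ∀ ψ : D, ‖X ψ‖ ≤ C * ‖(ψ : H)‖ := by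
  sorry

/-- **(L-B2) Chain growth with an arbitrary end constant forces the operator bound**
(iterated Schwarz: `‖Xψ‖² ≤ ‖ψ‖^(2-2^(-m)) (C_ψ Λ^(2·2^m))^(2^(-m)) → Λ²‖ψ‖²`). -/
theorem norm_le_of_chainGrowth
    (D : Submodule ℂ H) (X Xs : D →ₗ[ℂ] D)
    (hadj : ∀ φ ψ : D, ⟪(φ : H), ((X ψ : D) : H)⟫_ℂ = ⟪((Xs φ : D) : H), (ψ : H)⟫_ℂ)
    (ψ : D) (Λ Cψ : ℝ) (hΛ : 0 ≤ Λ) (hC : 0 ≤ Cψ)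
    (hchain : ∀ m : ℕ, ‖((((Xs ∘ₗ X) ^ (2 ^ m)) ψ : D) : H)‖ ≤ Cψ * Λ ^ (2 * 2 ^ m)) :
    ‖((X ψ : D) : H)‖ ≤ Λ * ‖(ψ : H)‖ := by
  sorry

end OperatorCore

section Polymer

/-- **(L-A1) Positive-activity polymer bound.** For nonnegative block activities `w`, the sum
over set partitions of the products of activities is at most `exp` of the total activity
(every partition is a sub-family of blocks: `∑_π ∏ w ≤ ∏_B (1 + w B) ≤ exp ∑_B w B`).
Used with `w B = |κ(B)| / λ^|B|`, `λ` = the pair scale `C·Mg·(Mh+Mh')·(u^-μ+v^-μ)`. -/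
theorem sum_finpartition_prod_le_exp {n : ℕ} (w : Finset (Fin n) → ℝ) (hw : ∀ B, 0 ≤ w B) :
    (∑ P : Finpartition (Finset.univ : Finset (Fin n)), ∏ B ∈ P.parts, w B)
      ≤ Real.exp (∑ B ∈ (Finset.univ : Finset (Fin n)).powerset, w B) := by
  sorry

/-- **(L-A2) Pinned sums control the total activity linearly in the chain length**:
if every index lies in blocks of size `m` of total activity `≤ θ m`, then
`∑_B w B ≤ n · ∑_m θ m / m` — so the growth rate `(∑_π ∏ w)^(1/n)` is `≤ exp (∑_m θ m / m)`,
INDEPENDENT of `n` (no factorial may hide in `θ`). -/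
theorem sum_activity_le_of_pinned {n : ℕ} (w : Finset (Fin n) → ℝ) (hw : ∀ B, 0 ≤ w B)
    (θ : ℕ → ℝ)
    (hpin : ∀ (j : Fin n) (m : ℕ),
      (∑ B ∈ ((Finset.univ : Finset (Fin n)).powerset.filter fun B => j ∈ B ∧ B.card = m), w B)
        ≤ θ m) :
    (∑ B ∈ ((Finset.univ : Finset (Fin n)).powerset.filter fun B => B.Nonempty), w B)
      ≤ n * ∑ m ∈ Finset.range (n + 1), θ m / m := by
  sorry


/-- **(L-A3) THE LEVER of card `pinned-cumulant-pressure`, typed for an abstract chain.**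
`Φ j` = the `j`-th chain insertion (a real random variable under the lattice Wilson measure at
step `k`; positions alternate reflected / translated copies of `f₁`), `ursell` = the tree's
truncated correlation.  FACTORIAL-FREE PINNED cumulant sums `≤ Λ^m θ_m` force the chain
moments to grow at most like `(Λ · e^{∑ θ_m/m})^N`: after dividing by the pair scale `Λ` the
`m`-clusters are `u^{m-2}`-small (transverse smearing), so `∑ θ_m / m = O(1)` and the growth
rate is the pair scale — the operator exponent equals the vacuum-row exponent. -/
theorem abs_nPoint_le_of_pinnedUrsell {Ω : Type*} [MeasurableSpace Ω]
    (μ : MeasureTheory.Measure Ω) [MeasureTheory.IsProbabilityMeasure μ] (Φ : ℕ → Ω → ℝ)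
    (hint : ∀ s : Finset ℕ, MeasureTheory.Integrable (fun ω => ∏ j ∈ s, Φ j ω) μ)
    (Λ : ℝ) (hΛ : 0 < Λ) (θ : ℕ → ℝ) (hθ : ∀ m, 0 ≤ θ m)
    (hpin : ∀ (N j m : ℕ),
      (∑ B ∈ ((Finset.range N).powerset.filter fun B => j ∈ B ∧ B.card = m),
          |Literature.Probability.LatticeModels.ursell μ Φ
              (fun i : Fin B.card => ((B.orderEmbOfFin rfl i : ℕ)))|) ≤ Λ ^ m * θ m) :
    ∀ N : ℕ, |Literature.Probability.LatticeModels.nPoint μ Φ (fun i : Fin N => (i : ℕ))| ≤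
      (Λ * Real.exp (∑ m ∈ Finset.range (N + 1), θ m / m)) ^ N := by
  sorry

end Polymer


section FrameTransfer

open Literature.MathematicalPhysics.QuantumLattice Literature.MathematicalPhysics.AQFT
  Literature.MathematicalPhysics.QuantumFieldTheory Literature.Probability.LatticeModels
  Summit.QuantumFields.YangMills.Theorems.CurvatureBoostCovariance.Negative
  Summit.QuantumFields.YangMills.Theorems.NPointIsotropy.Negative
open MeasureTheory

/-- ONE ROW of the crux's conclusion for a family `S` with FIXED exponent `μ` and constant `C`
(verbatim the inner block of `CurvatureSandwichBound`, quantified over every `e₀`-reconstruction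
`h` — a proof of a `Prop`, so `h.fieldVec` is canonical). -/
def SigmaRow (S : SchwingerFamily E4) (μ C : ℝ) : Prop :=
  ∀ (h : OSReconstructionNoE1 S.toLabelled) (u v : ℝ), 0 < u → 0 < v → u ≤ 1 → v ≤ 1 →
    ∀ (f₁ : SchwartzMap (Fin 1 → E4) ℂ) (g hh : ℝ × ℝ → ℂ) (Mg Mh Mh' : ℝ),
      (∀ x : Fin 1 → E4, f₁ x = g (x 0 0, x 0 1) * hh (x 0 2, x 0 3)) →
      (∀ p : ℝ × ℝ, g p ≠ 0 → u ≤ p.1 ∧ p.1 ≤ 2 * u) →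
      Integrable g → (∫ p, ‖g p‖) ≤ Mg → Integrable hh → (∫ p, ‖hh p‖) ≤ Mh →
      (∀ p, ‖hh p‖ ≤ Mh') →
      ∀ (n : ℕ) (W : SchwartzMap (Fin n → E4) ℂ) (hW : IsTimeOrdered W)
        (hFW : IsTimeOrdered (SchwartzMap.appendTensor f₁
          (translateMulti ((2 * u + v) • EuclideanSpace.single 0 1) W))),
        ‖h.fieldVec (1 + n) (fun _ => ()) (SchwartzMap.appendTensor f₁
            (translateMulti ((2 * u + v) • EuclideanSpace.single 0 1) W)) hFW‖ ≤
          C * Mg * (Mh + Mh') * (u ^ (-μ) + v ^ (-μ)) * ‖h.fieldVec n (fun _ => ()) W hW‖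

/-- The `45°` frame of the `(x₀,x₁)`-plane, named by its coordinates as in the crux. -/
def IsQuarterTurnFrame (R : E4 ≃ₗᵢ[ℝ] E4) : Prop :=
  ∀ x : E4, R x 0 = Real.cos (Real.pi / 4) * x 0 + Real.sin (Real.pi / 4) * x 1 ∧
    R x 1 = -Real.sin (Real.pi / 4) * x 0 + Real.cos (Real.pi / 4) * x 1 ∧ R x 2 = x 2 ∧ R x 3 = x 3

/-- **(L-B3) THE LEVER, typed — wedge-core frame transfer.** The axis row with exponent `μ`
forces the `45°` row with the SAME exponent (constant `C' = c_μ · C`), model-blindly: inputs are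
E0/E3/translations of `S₁` (for reordering and re-coordinatising configurations) and the planar
cone OF THE PULLED-BACK FAMILY (analyticity in the diagonal frame, used only to prove that the
admissible-end vectors are dense).  Proof route: σ-chopping (L¹-additivity) → admissible wedge
ends → diagonal chains read in `e₀`-time order → peel `2N` insertions by `SigmaRow S₁` →
`norm_le_of_chainGrowth` → `norm_le_of_denseCore_of_formalAdjoint`. -/
theorem sigmaRow_pullback_of_sigmaRow (S₁ : SchwingerFamily E4) (R : E4 ≃ₗᵢ[ℝ] E4)
    (hR : IsQuarterTurnFrame R) (hOS : OSPackage S₁) (hT : Translations S₁)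
    (hCone : PlanarCone (fun n => (S₁ n).comp (linActMulti R)))
    (μ C : ℝ) (hμ : 0 ≤ μ) (hC : 0 ≤ C) (hrow : SigmaRow S₁ μ C) :
    ∃ C' : ℝ, SigmaRow (fun n => (S₁ n).comp (linActMulti R)) μ C' := by
  sorry

/-- **(L-B4) Consequence for the crux as typed**: the axis conjunct alone (with `μ < 4`) plus
the cone of the pulled-back family gives BOTH conjuncts of `CurvatureSandwichBound`'s conclusion
— so the `45°` exponent of the item is not an extra bet (cf. lead c6's finding that the line only
consumes a weak `45°` row). -/
theorem bothRows_of_axisRow (S₁ : SchwingerFamily E4) (hOS : OSPackage S₁) (hT : Translations S₁)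
    (hCone : ∀ R : E4 ≃ₗᵢ[ℝ] E4, IsQuarterTurnFrame R →
      PlanarCone (fun n => (S₁ n).comp (linActMulti R)))
    (haxis : ∃ μ C : ℝ, 0 ≤ μ ∧ μ < 4 ∧ 0 ≤ C ∧ SigmaRow S₁ μ C) :
    (∃ μ C : ℝ, μ < 4 ∧ SigmaRow S₁ μ C) ∧
      ∀ R : E4 ≃ₗᵢ[ℝ] E4, IsQuarterTurnFrame R →
        ∃ μ C : ℝ, μ < 4 ∧ SigmaRow (fun n => (S₁ n).comp (linActMulti R)) μ C := by
  obtain ⟨μ, C, hμ, hμ4, hC, hrow⟩ := haxis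
  refine ⟨⟨μ, C, hμ4, hrow⟩, fun R hR => ?_⟩
  obtain ⟨C', h'⟩ := sigmaRow_pullback_of_sigmaRow S₁ R hR hOS hT (hCone R hR) μ C hμ hC hrow
  exact ⟨μ, C', hμ4, h'⟩

end FrameTransfer

end Summit.QuantumFields.YangMills.Cruxes.CurvatureSandwichBound.Ideation1
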